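import Mathlib.Analysis.Calculus.Deriv.MeanValue
import Mathlib.Analysis.Calculus.Deriv.Inv
import Literature.Probability.Percolation.SiteSharpnessDecay
import Literature.Probability.Percolation.SiteRusso
import HarnessLib

/-!
# Sharpness of the phase transition for site percolation, III: the mean-field lower bound

Topic `Literature/Probability/Percolation`. Fourth layer of the discharge of
`Literature.Probability.Percolation.triCriticalProb_eq_half` (Kesten 1982, §3.4: `p_c^site(𝕋) = 1/2`). Item 2 of
Duminil-Copin–Tassion's Thm. 1.1 (*Enseign. Math.* 62 (2016), Lemma 2.1 and §2.2; general
version *Comm. Math. Phys.* 343 (2016), Lemma 1.4 and §1.3), transcribed to **site** percolation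
on an arbitrary locally finite graph `G` with the functional `ψ_p(S) = Σ_{z ∈ ∂ⁱⁿS} P_p(F_z(S))`
of `SiteSharpnessStep.lean` (`dctPhi`):

* the random set `𝒮 = {z ∈ Λ : z ↮ ∂ⁱⁿΛ in Λ}` (DCT: "`𝒮 := {x ∈ Λ such that x ↮ Λᶜ}`"), the
  event `{𝒮 = S}` being written as the predicate `∀ z, z ∈ S ↔ z ∈ Λ ∧ ω ∉ exitEvent G Λ z`;
  `stuckSet_eq_iff` writes it out (all sites of `∂ⁱⁿS` are closed and every site of `Λ ∖ S` is
  joined to `∂ⁱⁿΛ` off `S`), so it is determined by the sites of `Λ ∖ I(S)`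
  (`determinedBy_stuckSet_eq`; DCT: "`{𝒮 = S}` is measurable with respect to the edges with one
  endpoint outside `S`");
* `stuckSet_eq_inter_dctEvent_subset` — on `{𝒮 = S} ∩ F_z(S)`, `z ∈ ∂ⁱⁿS`, the site `z` is
  (closed and) pivotal for `A = {x ⟷ ∂ⁱⁿΛ in Λ}` (DCT: on `{𝒮 = S}`, "`{x, y}` is pivotal" iff
  "`0 ⟷ x in S`");
* **`sum_closedPivotal_ge`** — the key inequality
  `α (1 - P_p(A)) ≤ Σ_{z ∈ Λ} P_p(ω ∉ A, ω ∪ {z} ∈ A)` whenever `0 ≤ α ≤ ψ_p(S)` for all `S` with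
  `x ∈ S ⊆ Λ` (DCT Lemma 2.1 / Lemma 1.4: independence of `{𝒮 = S}` and `{0 ⟷ x in S}`, then
  `Σ_{S ∋ 0} P[𝒮 = S] = 1 - P[0 ⟷ ∂Λ]`);
* `hasDerivAt_real_exitEvent_ge` — with Russo's formula (`SiteRusso.lean`):
  `d/dp P_p(A) ≥ (1 - p)⁻¹ α (1 - P_p(A))` (site form of DCT (2.1)/(1.6):
  `f' ≥ (1/p) inf_S φ_p(S) (1 - f)`);
* `oneSub_div_antitone` — the integration step: if `f' ≥ (1 - q)⁻¹ (1 - f)` on `[p₀, p]` then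
  `(1 - f(p))/(1 - p) ≤ (1 - f(p₀))/(1 - p₀)` (DCT: "integrating the differential inequality
  between `p̃_c` and `p`"), whence
* **`real_exitEvent_ge_meanField`**: if `ψ_q(S) ≥ 1` for all `q ∈ [p₀, p]` and all finite `S`
  with `x ∈ S ⊆ Λ`, then `P_p(x ⟷ ∂ⁱⁿΛ in Λ) ≥ (p - p₀)/(1 - p₀)`, uniformly in `Λ`, and
  **`siteTheta_ge_meanField`**: `θ_x(p) ≥ (p - p₀)/(1 - p₀)` (DCT Thm. 1.1 item 2, site
  version: `θ(p) ≥ (p - p̃_c)/(1 - p̃_c)`; the site normalisation of `ψ_p` has no factor `p`).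

## References

* H. Duminil-Copin, V. Tassion, A new proof of the sharpness of the phase transition for
  Bernoulli percolation on `ℤ^d`, *Enseign. Math.* 62 (2016) 199–206, Thm. 1.1 item 2,
  Lemma 2.1, §2.2 [DuminilCopinTassionEM2016].
* H. Duminil-Copin, V. Tassion, *Comm. Math. Phys.* 343 (2016) 725–745, Thm. 1.1 item 1,
  Lemma 1.4, §1.3 (site percolation: §1.2 "the proof may be adapted to site percolation")
  [DuminilCopinTassionCMP2016].
* H. Kesten, *Percolation theory for mathematicians*, Birkhäuser 1982, §3.4.

## Mathlib / tree

Mathlib: `antitoneOn_of_hasDerivWithinAt_nonpos`, `HasDerivAt.mul`, `HasDerivAt.inv`,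
`measureReal_biUnion_finset(_le)`, `Finset.sum_comm`. Tree: `exitEvent`, `isUpperSet_exitEvent`,
`determinedBy_exitEvent`, `tendsto_siteTheta` (`SiteMonotonicity.lean`), `exitEvent_anti`
(`SiteSharpnessDecay.lean`), `dctPhi`, `dctEvent`, `siteInterior` (`SiteSharpnessStep.lean`),
`site_russo_formula_sum_closedPivotal`, `setOf_not_mem_and_insert_mem_eq` (`SiteRusso.lean`),
`PathIn.exit_or` (`SitePaths.lean`), `sitePercolation_real_inter_of_disjoint`
(`SitePercolationMeasure.lean`), `Russo.determinedBy_isPivotal` (`RussoFormula.lean`).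
-/

noncomputable section

open MeasureTheory Filter Topology Literature.Probability.Percolation

namespace Literature.Probability.Percolation

variable {V : Type*}

/-! ### The random set `𝒮` of sites not joined to `∂ⁱⁿΛ` -/

section Stuck

variable {G : SimpleGraph V} [DecidableEq V] [G.LocallyFinite]

/-! Throughout, `𝒮(ω) = {z ∈ Λ : z ↮ ∂ⁱⁿΛ in Λ}` is the random set of sites of `Λ` not joined
inside `Λ` by an open path to the inner boundary of `Λ` (closed sites of `Λ` included;
Duminil-Copin–Tassion, Enseign. Math. 2016, proof of Lemma 2.1: "`𝒮 := {x ∈ Λ_n such that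
x ↮ ∂Λ_n}`"), and the event `{𝒮 = S}` is written as the predicate
`∀ z, z ∈ S ↔ z ∈ Λ ∧ ω ∉ exitEvent G Λ z` on `ω` (no auxiliary definition is introduced). -/

/-- **On `{𝒮 = S}` the inner boundary sites of `S` are closed**: an open `z ∈ ∂ⁱⁿS` has a
neighbour `y ∉ S`; if `y ∉ Λ` then `z ∈ ∂ⁱⁿΛ` is trivially joined to `∂ⁱⁿΛ`, and if `y ∈ Λ ∖ S`
then `y`, hence `z`, is joined to `∂ⁱⁿΛ` — either way `z ∉ 𝒮 = S`. [cite: DuminilCopinTassionEM2016, Lemma 2.1 (proof)] -/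
theorem not_mem_of_stuckSet_eq {Λ S : Finset V} {ω : SiteConfig V}
    (h : ∀ z, z ∈ S ↔ z ∈ Λ ∧ ω ∉ exitEvent G Λ z) {z : V} (hz : z ∈ LatticeModels.innerBoundary G S) :
    z ∉ ω := by
  intro hzω
  obtain ⟨hzS, y, hyS, hzy⟩ := LatticeModels.mem_innerBoundary_iff.1 hz
  obtain ⟨hzΛ, hzexit⟩ := (h z).1 hzS
  apply hzexit
  by_cases hyΛ : y ∈ Λ
  · have hy : ω ∈ exitEvent G Λ y := by
      by_contra hy
      exact hyS ((h y).2 ⟨hyΛ, hy⟩)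
    obtain ⟨b, hb, hyb⟩ := mem_exitEvent_iff.1 hy
    exact mem_exitEvent_iff.2 ⟨b, hb, siteConnIn_trans G subset_rfl subset_rfl
      (mem_siteConnIn_of_adj G hzω hyb.1 hzΛ hyΛ hzy) hyb⟩
  · exact mem_exitEvent_iff.2 ⟨z, LatticeModels.mem_innerBoundary_iff.2 ⟨hzΛ, y, hyΛ, hzy⟩,
      mem_siteConnIn_self G hzω hzΛ⟩

/-- **`{𝒮 = S}` written out** for `S ⊆ Λ`: `𝒮 = S` iff every inner boundary site of `S` is closed
and every site of `Λ ∖ S` is joined to `∂ⁱⁿΛ` by an open path of sites of `Λ ∖ S`. (`⇒`: a path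
from `z ∈ Λ ∖ S` to `∂ⁱⁿΛ` cannot enter `S`, since it would do so through an open site of `∂ⁱⁿS`;
`⇐`: a path from `z ∈ S` to `∂ⁱⁿΛ` either stays in `S` and ends at a site of `S ∩ ∂ⁱⁿΛ ⊆ ∂ⁱⁿS`, or
leaves `S` through a site of `∂ⁱⁿS`, both closed. DCT, Enseign. Math. 2016, proof of Lemma 2.1:
"the boundary of `𝒮` corresponds to the outmost blocking surface".) [cite: DuminilCopinTassionEM2016, Lemma 2.1 (proof)] -/
theorem stuckSet_eq_iff {Λ S : Finset V} (hSΛ : S ⊆ Λ) {ω : SiteConfig V} :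
    (∀ z, z ∈ S ↔ z ∈ Λ ∧ ω ∉ exitEvent G Λ z) ↔
      (∀ z ∈ LatticeModels.innerBoundary G S, z ∉ ω) ∧
        ∀ z ∈ Λ \ S, ∃ b ∈ LatticeModels.innerBoundary G Λ, ω ∈ siteConnIn G ↑(Λ \ S) z b := by
  constructor
  · intro h
    refine ⟨fun z hz => not_mem_of_stuckSet_eq h hz, fun z hz => ?_⟩
    obtain ⟨hzΛ, hzS⟩ := Finset.mem_sdiff.1 hz
    have hex : ω ∈ exitEvent G Λ z := by
      by_contra hex
      exact hzS ((h z).2 ⟨hzΛ, hex⟩)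
    obtain ⟨b, hb, hzb⟩ := mem_exitEvent_iff.1 hex
    refine ⟨b, hb, ?_⟩
    have hp : PathIn G (↑Λ ∩ ω) z b := PathIn.of_mem_siteConnIn hzb
    rcases hp.exit_or (R := (↑S : Set V)ᶜ) (fun h' => hzS h') with
      hp' | ⟨a, c, haS, hcS, hcA, hac, -⟩
    · refine PathIn.mem_siteConnIn (hp'.mono ?_)
      rintro u ⟨huS, huΛ, huω⟩
      exact ⟨Finset.mem_coe.2 (Finset.mem_sdiff.2 ⟨huΛ, huS⟩), huω⟩
    · have hcS' : c ∈ S := by simpa using hcS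
      exact absurd hcA.2 (not_mem_of_stuckSet_eq h
        (LatticeModels.mem_innerBoundary_iff.2 ⟨hcS', a, fun ha => haS ha, hac.symm⟩))
  · rintro ⟨hcl, hconn⟩ z
    constructor
    · intro hzS
      refine ⟨hSΛ hzS, fun hz => ?_⟩
      obtain ⟨b, hb, hzb⟩ := mem_exitEvent_iff.1 hz
      have hp : PathIn G (↑Λ ∩ ω) z b := PathIn.of_mem_siteConnIn hzb
      rcases hp.exit_or (R := (↑S : Set V)) hzS with hp' | ⟨a, c, haS, hcS, -, hac, hza⟩
      · have hbmem := hp'.right_mem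
        obtain ⟨-, y, hyΛ, hby⟩ := LatticeModels.mem_innerBoundary_iff.1 hb
        exact hcl b (LatticeModels.mem_innerBoundary_iff.2 ⟨hbmem.1, y, fun hyS => hyΛ (hSΛ hyS), hby⟩)
          hbmem.2.2
      · have hamem := hza.right_mem
        exact hcl a (LatticeModels.mem_innerBoundary_iff.2 ⟨hamem.1, c, hcS, hac⟩) hamem.2.2
    · rintro ⟨hzΛ, hz⟩
      by_contra hzS
      obtain ⟨b, hb, hzb⟩ := hconn z (Finset.mem_sdiff.2 ⟨hzΛ, hzS⟩)
      exact hz (mem_exitEvent_iff.2 ⟨b, hb,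
        siteConnIn_mono_set G (Finset.coe_subset.2 Finset.sdiff_subset) z b hzb⟩)

/-- **`{𝒮 = S}` is determined by the sites of `Λ ∖ I(S)`** (`S ⊆ Λ`): by `stuckSet_eq_iff` it is
the closedness of `∂ⁱⁿS` together with connections inside `Λ ∖ S`. (DCT 2016: "`{𝒮 = S}` is
measurable with respect to the state of edges having one endpoint in `V ∖ S`".) [cite: DuminilCopinTassionEM2016, Lemma 2.1 (proof)] -/
theorem determinedBy_stuckSet_eq {Λ S : Finset V} (hSΛ : S ⊆ Λ) :
    DeterminedBy {ω : SiteConfig V | ∀ z, z ∈ S ↔ z ∈ Λ ∧ ω ∉ exitEvent G Λ z}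
      ↑(Λ \ siteInterior G S) := by
  have hset : {ω : SiteConfig V | ∀ z, z ∈ S ↔ z ∈ Λ ∧ ω ∉ exitEvent G Λ z} =
      (⋂ z ∈ LatticeModels.innerBoundary G S, {ω | z ∉ ω}) ∩
        ⋂ z ∈ Λ \ S, ⋃ b ∈ LatticeModels.innerBoundary G Λ, siteConnIn G ↑(Λ \ S) z b := by
    ext ω
    rw [Set.mem_setOf_eq, stuckSet_eq_iff hSΛ]
    simp
  rw [hset]
  refine DeterminedBy.inter ?_ ?_
  · refine DeterminedBy.iInter fun z => DeterminedBy.iInter fun hz => ?_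
    refine ((determinedBy_mem z).compl).mono ?_
    intro u hu
    rw [Set.mem_singleton_iff] at hu
    subst hu
    have hzS : u ∈ S := (LatticeModels.mem_innerBoundary_iff.1 hz).1
    refine Finset.mem_coe.2 (Finset.mem_sdiff.2 ⟨hSΛ hzS, fun huI => ?_⟩)
    exact (Finset.mem_sdiff.1 huI).2 hz
  · refine DeterminedBy.iInter fun z => DeterminedBy.iInter fun _ =>
      DeterminedBy.iUnion fun b => DeterminedBy.iUnion fun _ => ?_
    refine (determinedBy_siteConnIn G _ z b).mono (Finset.coe_subset.2 ?_)
    exact Finset.sdiff_subset_sdiff subset_rfl (siteInterior_subset S)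

/-- **Pivotality on `{𝒮 = S} ∩ F_z(S)`.** For `x ∈ S ⊆ Λ` and `z ∈ ∂ⁱⁿS`: on `{𝒮 = S} ∩ F_z(S)` the
event `A = {x ⟷ ∂ⁱⁿΛ in Λ}` fails (as `x ∈ 𝒮`) but occurs after opening `z`: `z` has a neighbour
`y ∉ S`, joined to `∂ⁱⁿΛ` if `y ∈ Λ` (as `y ∉ 𝒮`) and witnessing `z ∈ ∂ⁱⁿΛ` otherwise, while `F_z(S)`
joins `x` to a neighbour of `z` (or `z = x`). (DCT 2016, proof of Lemma 2.1: on `{𝒮 = S}` the edge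
`{x, y} ∈ ΔS` is pivotal iff `0 ⟷ x` in `S`.) [cite: DuminilCopinTassionEM2016, Lemma 2.1 (proof)] -/
theorem stuckSet_eq_inter_dctEvent_subset {Λ S : Finset V} (hSΛ : S ⊆ Λ) {x z : V} (hxS : x ∈ S)
    (hz : z ∈ LatticeModels.innerBoundary G S) {ω : SiteConfig V}
    (hω : ∀ z, z ∈ S ↔ z ∈ Λ ∧ ω ∉ exitEvent G Λ z) (hF : ω ∈ dctEvent G S x z) :
    ω ∉ exitEvent G Λ x ∧ insert z ω ∈ exitEvent G Λ x := by
  refine ⟨((hω x).1 hxS).2, ?_⟩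
  obtain ⟨hzS, y, hyS, hzy⟩ := LatticeModels.mem_innerBoundary_iff.1 hz
  have hzΛ : z ∈ Λ := hSΛ hzS
  have hzω' : z ∈ insert z ω := Set.mem_insert z ω
  have hle : ω ⊆ insert z ω := Set.subset_insert z ω
  -- after opening `z`, the site `z` is joined to `∂ⁱⁿΛ`
  have hz' : insert z ω ∈ exitEvent G Λ z := by
    by_cases hyΛ : y ∈ Λ
    · have hy : ω ∈ exitEvent G Λ y := by
        by_contra hy
        exact hyS ((hω y).2 ⟨hyΛ, hy⟩)
      obtain ⟨b, hb, hyb⟩ := mem_exitEvent_iff.1 (isUpperSet_exitEvent Λ y hle hy)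
      exact mem_exitEvent_iff.2 ⟨b, hb, siteConnIn_trans G subset_rfl subset_rfl
        (mem_siteConnIn_of_adj G hzω' hyb.1 hzΛ hyΛ hzy) hyb⟩
    · exact mem_exitEvent_iff.2 ⟨z, LatticeModels.mem_innerBoundary_iff.2 ⟨hzΛ, y, hyΛ, hzy⟩,
        mem_siteConnIn_self G hzω' hzΛ⟩
  rcases hF with rfl | ⟨w, hzw, hxw⟩
  · exact hz'
  · obtain ⟨b, hb, hzb⟩ := mem_exitEvent_iff.1 hz'
    have hxw' : insert z ω ∈ siteConnIn G ↑Λ x w :=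
      siteConnIn_mono_set G (Finset.coe_subset.2 ((siteInterior_subset S).trans hSΛ)) x w
        (siteConnIn_isUpperSet G _ x w hle hxw)
    have hwω' : w ∈ insert z ω := hxw'.2.1
    obtain ⟨_, hwΛ, _⟩ := hxw'.2.2
    have hwz : insert z ω ∈ siteConnIn G ↑Λ w z :=
      mem_siteConnIn_of_adj G hwω' hzω' hwΛ hzΛ hzw.symm
    exact mem_exitEvent_iff.2 ⟨b, hb, siteConnIn_trans G subset_rfl subset_rfl
      (siteConnIn_trans G subset_rfl subset_rfl hxw' hwz) hzb⟩

end Stuck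

/-! ### The key inequality and the differential inequality -/

section KeyInequality

variable {G : SimpleGraph V} [DecidableEq V] [G.LocallyFinite]

/-- **Key inequality** (site version of Duminil-Copin–Tassion, Enseign. Math. 2016, proof of
Lemma 2.1; CMP 2016, proof of Lemma 1.4). Let `A = {x ⟷ ∂ⁱⁿΛ in Λ}` with `x ∈ Λ` finite, and
suppose `0 ≤ α ≤ ψ_p(S)` for every `S` with `x ∈ S ⊆ Λ`. Then
`α · (1 - P_p(A)) ≤ Σ_{z ∈ Λ} P_p(ω ∉ A, ω ∪ {z} ∈ A)`.
Proof: `1 - P(A) ≤ Σ_{S} P(𝒮 = S)` over `S ∋ x`; `α P(𝒮 = S) ≤ ψ_p(S) P(𝒮 = S)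
= Σ_{z ∈ ∂ⁱⁿS} P(F_z(S) ∩ {𝒮 = S})` by independence (disjoint supports `I(S)` and `Λ ∖ I(S)`);
`F_z(S) ∩ {𝒮 = S} ⊆ {ω ∉ A, ω ∪ {z} ∈ A} ∩ {𝒮 = S}`; and the events `{𝒮 = S}` are disjoint.
[cite: DuminilCopinTassionEM2016, Lemma 2.1 (proof)] -/
theorem sum_closedPivotal_ge (p : unitInterval) {Λ : Finset V} {x : V} (hx : x ∈ Λ) {α : ℝ}
    (hα0 : 0 ≤ α) (hα : ∀ S : Finset V, S ⊆ Λ → x ∈ S → α ≤ dctPhi G p S x) :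
    α * (1 - (sitePercolation V p).real (exitEvent G Λ x)) ≤
      ∑ z ∈ Λ, (sitePercolation V p).real
        {ω | ω ∉ exitEvent G Λ x ∧ insert z ω ∈ exitEvent G Λ x} := by
  classical
  set P := sitePercolation V p with hP
  set A := exitEvent G Λ x with hA
  set 𝓕 : Finset (Finset V) := Λ.powerset.filter fun S => x ∈ S with h𝓕
  set T : Finset V → Set (SiteConfig V) :=
    fun S => {ω | ∀ z, z ∈ S ↔ z ∈ Λ ∧ ω ∉ exitEvent G Λ z} with hT
  set E : V → Set (SiteConfig V) := fun z => {ω | ω ∉ A ∧ insert z ω ∈ A} with hE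
  have h𝓕mem : ∀ {S : Finset V}, S ∈ 𝓕 ↔ S ⊆ Λ ∧ x ∈ S := by
    intro S
    simp [h𝓕]
  have hTdet : ∀ S ∈ 𝓕, DeterminedBy (T S) ↑(Λ \ siteInterior G S) := fun S hS =>
    determinedBy_stuckSet_eq (h𝓕mem.1 hS).1
  have hTmeas : ∀ S ∈ 𝓕, MeasurableSet (T S) := fun S hS =>
    (hTdet S hS).measurableSet_of_finset
  have hEmeas : ∀ z, MeasurableSet (E z) := by
    intro z
    have : E z = {ω | IsPivotal A z ω} ∩ {ω | z ∉ ω} :=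
      setOf_not_mem_and_insert_mem_eq (isUpperSet_exitEvent Λ x) z
    rw [this]
    exact (Russo.determinedBy_isPivotal (determinedBy_exitEvent Λ x) z).measurableSet_of_finset.inter
      (measurableSet_mem z).compl
  -- `Aᶜ ⊆ ⋃_{S ∋ x} {𝒮 = S}`
  have hcover : Aᶜ ⊆ ⋃ S ∈ 𝓕, T S := by
    intro ω hω
    simp only [Set.mem_iUnion]
    refine ⟨Λ.filter fun z => ω ∉ exitEvent G Λ z,
      h𝓕mem.2 ⟨Finset.filter_subset _ _, Finset.mem_filter.2 ⟨hx, hω⟩⟩, fun z => ?_⟩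
    simp only [Finset.mem_filter]
  have h1 : 1 - P.real A ≤ ∑ S ∈ 𝓕, P.real (T S) := by
    rw [← probReal_compl_eq_one_sub (measurableSet_exitEvent Λ x)]
    exact (measureReal_mono hcover (measure_ne_top _ _)).trans (measureReal_biUnion_finset_le _ _)
  -- the bound for one `S`
  have h2 : ∀ S ∈ 𝓕, α * P.real (T S) ≤ ∑ z ∈ Λ, P.real (E z ∩ T S) := by
    intro S hS
    obtain ⟨hSΛ, hxS⟩ := h𝓕mem.1 hS
    calc α * P.real (T S) ≤ dctPhi G p S x * P.real (T S) :=
          mul_le_mul_of_nonneg_right (hα S hSΛ hxS) measureReal_nonneg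
      _ = ∑ z ∈ LatticeModels.innerBoundary G S, P.real (dctEvent G S x z ∩ T S) := by
          rw [dctPhi, Finset.sum_mul]
          refine Finset.sum_congr rfl fun z _ => ?_
          rw [sitePercolation_real_inter_of_disjoint p (determinedBy_dctEvent S x z) (hTdet S hS)
            Finset.disjoint_sdiff]
      _ ≤ ∑ z ∈ LatticeModels.innerBoundary G S, P.real (E z ∩ T S) := by
          refine Finset.sum_le_sum fun z hz => measureReal_mono ?_ (measure_ne_top _ _)
          rintro ω ⟨hFz, hω⟩
          exact ⟨stuckSet_eq_inter_dctEvent_subset hSΛ hxS hz hω hFz, hω⟩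
      _ ≤ ∑ z ∈ Λ, P.real (E z ∩ T S) :=
          Finset.sum_le_sum_of_subset_of_nonneg
            (fun z hz => hSΛ (LatticeModels.mem_innerBoundary_iff.1 hz).1) fun _ _ _ => measureReal_nonneg
  -- sum over `S` and exchange the sums
  calc α * (1 - P.real A) ≤ α * ∑ S ∈ 𝓕, P.real (T S) := mul_le_mul_of_nonneg_left h1 hα0
    _ = ∑ S ∈ 𝓕, α * P.real (T S) := Finset.mul_sum _ _ _
    _ ≤ ∑ S ∈ 𝓕, ∑ z ∈ Λ, P.real (E z ∩ T S) := Finset.sum_le_sum h2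
    _ = ∑ z ∈ Λ, ∑ S ∈ 𝓕, P.real (E z ∩ T S) := Finset.sum_comm
    _ = ∑ z ∈ Λ, P.real (⋃ S ∈ 𝓕, (E z ∩ T S)) := by
        refine Finset.sum_congr rfl fun z _ => ?_
        rw [measureReal_biUnion_finset ?_ fun S hS => (hEmeas z).inter (hTmeas S hS)]
        intro S _ S' _ hne
        rw [Function.onFun, Set.disjoint_left]
        rintro ω ⟨-, hω⟩ ⟨-, hω'⟩
        exact hne (Finset.ext fun z => (hω z).trans (hω' z).symm)
    _ ≤ ∑ z ∈ Λ, P.real (E z) := Finset.sum_le_sum fun z _ =>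
        measureReal_mono (Set.iUnion₂_subset fun S _ => Set.inter_subset_left) (measure_ne_top _ _)

/-- **The differential inequality** (site version of Duminil-Copin–Tassion, Enseign. Math. 2016,
Lemma 2.1, (2.1); CMP 2016, Lemma 1.4, (1.6)): for `x ∈ Λ` finite, `p ∈ (0, 1)`, and
`0 ≤ α ≤ ψ_p(S)` for all `S` with `x ∈ S ⊆ Λ`, the function `q ↦ P_q(x ⟷ ∂ⁱⁿΛ in Λ)` has a
derivative `D` at `p` with `D ≥ (1 - p)⁻¹ α (1 - P_p(x ⟷ ∂ⁱⁿΛ in Λ))` (Russo's formula and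
`sum_closedPivotal_ge`). [cite: DuminilCopinTassionEM2016, Lemma 2.1 (2.1)] -/
theorem hasDerivAt_real_exitEvent_ge {Λ : Finset V} {x : V} (hx : x ∈ Λ) {p : ℝ}
    (hp : p ∈ Set.Ioo (0 : ℝ) 1) {α : ℝ} (hα0 : 0 ≤ α)
    (hα : ∀ S : Finset V, S ⊆ Λ → x ∈ S →
      α ≤ dctPhi G (Set.projIcc 0 1 zero_le_one p) S x) :
    ∃ D : ℝ,
      HasDerivAt (fun q : ℝ =>
        (sitePercolation V (Set.projIcc 0 1 zero_le_one q)).real (exitEvent G Λ x)) D p ∧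
      (1 - p)⁻¹ * (α * (1 - (sitePercolation V (Set.projIcc 0 1 zero_le_one p)).real
        (exitEvent G Λ x))) ≤ D := by
  refine ⟨_, site_russo_formula_sum_closedPivotal (isUpperSet_exitEvent Λ x) Λ
    (determinedBy_exitEvent Λ x) hp, ?_⟩
  exact mul_le_mul_of_nonneg_left (sum_closedPivotal_ge _ hx hα0 hα)
    (inv_nonneg.2 (sub_pos.2 hp.2).le)

end KeyInequality

/-! ### Integration of the differential inequality -/

/-- **Integration step** (Duminil-Copin–Tassion, Enseign. Math. 2016, §2.2: "integrating the
differential inequality (2.1) between `p̃_c` and `p`"; here in the site normalisation). If `f` is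
differentiable on `[p₀, p] ⊆ (-∞, 1)` with `f'(q) ≥ (1 - q)⁻¹ (1 - f(q))`, then
`q ↦ (1 - f(q))/(1 - q)` is non-increasing on `[p₀, p]`; in particular
`(1 - f(p))/(1 - p) ≤ (1 - f(p₀))/(1 - p₀)`. (Its derivative is
`((1 - f) - f' (1 - q))/(1 - q)² ≤ 0`.) [cite: DuminilCopinTassionEM2016, §2.2 (proof of Thm. 1.1, item 2)] -/
theorem oneSub_div_antitone {f f' : ℝ → ℝ} {p₀ p : ℝ} (hp₀p : p₀ ≤ p) (hp1 : p < 1)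
    (hf : ∀ q ∈ Set.Icc p₀ p, HasDerivAt f (f' q) q)
    (hf' : ∀ q ∈ Set.Icc p₀ p, (1 - q)⁻¹ * (1 - f q) ≤ f' q) :
    (1 - f p) / (1 - p) ≤ (1 - f p₀) / (1 - p₀) := by
  set g : ℝ → ℝ := fun q => (1 - f q) / (1 - q) with hg
  set g' : ℝ → ℝ := fun q => ((1 - f q) - f' q * (1 - q)) / (1 - q) ^ 2 with hg'
  -- the derivative of `g`
  have hgd : ∀ q ∈ Set.Icc p₀ p, HasDerivAt g (g' q) q := by
    intro q hq
    have hq1 : 1 - q ≠ 0 := (sub_pos.2 (hq.2.trans_lt hp1)).ne'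
    have h1 : HasDerivAt (fun q => 1 - f q) (0 - f' q) q :=
      (hasDerivAt_const q (1 : ℝ)).sub (hf q hq)
    have h2 : HasDerivAt (fun q : ℝ => 1 - q) (0 - 1) q :=
      (hasDerivAt_const q (1 : ℝ)).sub (hasDerivAt_id q)
    have h3 := h1.div h2 hq1
    refine h3.congr_deriv ?_
    simp only [hg']
    field_simp
    ring
  have hg_nonpos : ∀ q ∈ Set.Icc p₀ p, g' q ≤ 0 := by
    intro q hq
    simp only [hg']
    have hq1 : 0 < 1 - q := sub_pos.2 (hq.2.trans_lt hp1)
    refine div_nonpos_of_nonpos_of_nonneg ?_ (sq_nonneg _)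
    have := hf' q hq
    rw [inv_mul_le_iff₀ hq1] at this
    linarith
  have hanti : AntitoneOn g (Set.Icc p₀ p) := by
    refine antitoneOn_of_hasDerivWithinAt_nonpos (f' := g') (convex_Icc p₀ p)
      (fun q hq => (hgd q hq).continuousAt.continuousWithinAt) (fun q hq => ?_) fun q hq => ?_
    · exact (hgd q (interior_subset hq)).hasDerivWithinAt
    · exact hg_nonpos q (interior_subset hq)
  exact hanti (Set.left_mem_Icc.2 hp₀p) (Set.right_mem_Icc.2 hp₀p) hp₀p

/-! ### The mean-field lower bound -/

section MeanField

variable {G : SimpleGraph V} [DecidableEq V] [G.LocallyFinite]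

/-- **Mean-field lower bound in finite volume** (site version of Duminil-Copin–Tassion, Enseign.
Math. 2016, §2.2: "for every `n ≥ 1`, `P_p[0 ⟷ ∂Λ_n] ≥ (p - p̃_c)/(p(1 - p̃_c))`"; CMP 2016, §1.3).
If `0 < p₀ ≤ p < 1` and `ψ_q(S) ≥ 1` for every `q ∈ [p₀, p]` and every `S` with `x ∈ S ⊆ Λ`, then
`P_p(x ⟷ ∂ⁱⁿΛ in Λ) ≥ (p - p₀)/(1 - p₀)`. [cite: DuminilCopinTassionEM2016, §2.2 (proof of Thm. 1.1, item 2)] -/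
theorem real_exitEvent_ge_meanField {Λ : Finset V} {x : V} (hx : x ∈ Λ) {p₀ : ℝ} (hp₀ : 0 < p₀)
    {p : unitInterval} (hp₀p : p₀ ≤ p) (hp1 : (p : ℝ) < 1)
    (hψ : ∀ q : unitInterval, p₀ ≤ (q : ℝ) → (q : ℝ) ≤ p →
      ∀ S : Finset V, S ⊆ Λ → x ∈ S → 1 ≤ dctPhi G q S x) :
    ((p : ℝ) - p₀) / (1 - p₀) ≤ (sitePercolation V p).real (exitEvent G Λ x) := by
  set f : ℝ → ℝ := fun q =>
    (sitePercolation V (Set.projIcc 0 1 zero_le_one q)).real (exitEvent G Λ x) with hf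
  -- derivative and differential inequality on `[p₀, p]`
  have hD : ∀ q ∈ Set.Icc p₀ (p : ℝ), ∃ D : ℝ, HasDerivAt f D q ∧ (1 - q)⁻¹ * (1 - f q) ≤ D := by
    intro q hq
    have hq01 : q ∈ Set.Ioo (0 : ℝ) 1 := ⟨hp₀.trans_le hq.1, hq.2.trans_lt hp1⟩
    have hqI : (Set.projIcc 0 1 zero_le_one q : ℝ) = q :=
      congrArg Subtype.val (Set.projIcc_of_mem zero_le_one ⟨hq01.1.le, hq01.2.le⟩)
    obtain ⟨D, hDf, hDge⟩ := hasDerivAt_real_exitEvent_ge (G := G) hx hq01 zero_le_one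
      fun S hS hxS => hψ _ (by rw [hqI]; exact hq.1) (by rw [hqI]; exact hq.2) S hS hxS
    exact ⟨D, hDf, by simpa [hf] using hDge⟩
  choose! D hDf hDge using hD
  have hstep := oneSub_div_antitone hp₀p hp1 hDf hDge
  -- `f p = P_p(A)`, `f p₀ ≥ 0`
  have hfp : f p = (sitePercolation V p).real (exitEvent G Λ x) := by
    simp only [hf]
    rw [Set.projIcc_val zero_le_one p]
  have hfp₀ : 0 ≤ f p₀ := measureReal_nonneg
  have h1p₀ : 0 < 1 - p₀ := sub_pos.2 (hp₀p.trans_lt hp1)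
  have h1p : 0 < 1 - (p : ℝ) := sub_pos.2 hp1
  rw [hfp] at hstep
  rw [div_le_iff₀ h1p₀]
  have h2 : (1 - (sitePercolation V p).real (exitEvent G Λ x)) / (1 - (p : ℝ)) ≤ 1 / (1 - p₀) :=
    hstep.trans (div_le_div_of_nonneg_right (by linarith) h1p₀.le)
  rw [div_le_div_iff₀ h1p h1p₀] at h2
  nlinarith [h2, h1p, h1p₀]

/-- **Mean-field lower bound for `θ`** (site version of Duminil-Copin–Tassion 2016, Thm. 1.1,
item 2: `θ(p) ≥ (p - p̃_c)/(p (1 - p̃_c))` for bond percolation, and CMP 2016 §1.2 for the site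
adaptation). On a locally finite graph with countably many sites: if `0 < p₀ ≤ p < 1` and
`ψ_q(S) ≥ 1` for every `q ∈ [p₀, p]` and every finite `S ∋ x`, then
`θ_x(p) ≥ (p - p₀)/(1 - p₀)`; in particular `θ_x(p) > 0` for `p > p₀`. [cite: DuminilCopinTassionEM2016, Thm. 1.1 item 2] -/
theorem siteTheta_ge_meanField [Countable V] (x : V) {p₀ : ℝ} (hp₀ : 0 < p₀) {p : unitInterval}
    (hp₀p : p₀ ≤ p) (hp1 : (p : ℝ) < 1)
    (hψ : ∀ q : unitInterval, p₀ ≤ (q : ℝ) → (q : ℝ) ≤ p →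
      ∀ S : Finset V, x ∈ S → 1 ≤ dctPhi G q S x) :
    ((p : ℝ) - p₀) / (1 - p₀) ≤ siteTheta G x p := by
  classical
  -- an increasing exhausting sequence of finite sets containing `x`
  have : Nonempty V := ⟨x⟩
  obtain ⟨e, he⟩ := exists_surjective_nat V
  set Λ : ℕ → Finset V := fun n => insert x ((Finset.range n).image e) with hΛ
  have hmono : Monotone Λ := fun m n hmn =>
    Finset.insert_subset_insert _ (Finset.image_subset_image (Finset.range_subset_range.2 hmn))
  have hex : ∀ v, ∃ n, v ∈ Λ n := by
    intro v
    obtain ⟨k, rfl⟩ := he v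
    exact ⟨k + 1, Finset.mem_insert_of_mem (Finset.mem_image_of_mem e (by simp))⟩
  have hx0 : x ∈ Λ 0 := Finset.mem_insert_self _ _
  have hlim := tendsto_siteTheta (G := G) hmono hex hx0 p
  refine ge_of_tendsto' hlim fun n => ?_
  have hxn : x ∈ Λ n := hmono (Nat.zero_le n) hx0
  calc ((p : ℝ) - p₀) / (1 - p₀) ≤ (sitePercolation V p).real (exitEvent G (Λ n) x) :=
        real_exitEvent_ge_meanField hxn hp₀ hp₀p hp1 fun q hq hq' S _ hxS => hψ q hq hq' S hxS
    _ ≤ (sitePercolation V p).real (⋂ m ≤ n, exitEvent G (Λ m) x) := by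
        refine measureReal_mono ?_ (measure_ne_top _ _)
        exact Set.subset_iInter₂ fun m hm => exitEvent_anti (hmono hm) (hmono (Nat.zero_le m) hx0)

end MeanField

end Literature.Probability.Percolation
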